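import Mathlib
import HarnessLib
import Summits.HubbardSuperconductivity.HubbardSuperconductivity.Theorems.KLProgrammeKLRegimeWickMixedContraction

/-!
# Route `KLProgramme` — crux K3, ENGINE child (stmt-HubbardSuperconductivity-19855 / V14 successor), (E2-v9): the FEYNMAN RULE FOR THE TWO-LINE
# (bubble) TERM at a SORTED leg colouring — both ladder colourings `(1,1,0,0)` and `(0,0,1,1)` (cell gate-hubbard-kl, seat p1 g8)

E2-WICK-ROADMAP §5 (ii)/(iii), first instalment.  The two-line part of the second-order Wick term is `Δ_×(C₁)Δ_×(C₂)(𝒲⁰𝒲¹)` folded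
(`klw_rung_pairs`: pairs `g⊗g`, `g⊗D`, `D⊗g`).  Its 4-leg kernel at labels `Z = (Z₀,Z₁,Z₂,Z₃)` is, by `kernel_dblFold`, a sum over the `2⁴` colourings
`s : Fin 4 → Fin 2`; for quartic vertices only the `2+2` colourings survive, and the two PARTICLE–PARTICLE LADDER colourings at the pair labels of
`klPairAmplitude` (legs `0,1` = outgoing pair `ψ⁺ψ⁺`, legs `2,3` = incoming pair `ψ⁻ψ⁻`) are the SORTED ones, `s = (1,1,0,0)` and `s = (0,0,1,1)`.  For these
the block product rule needs no shuffle sign: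

* `constPart_iterDeriv_copyZero_copyOne` — the mirror of p485455's block rule: copy-`0` derivatives applied FIRST, then copy-`1`:
  `constPart (∂_{Ỹ} ∂_{X̃} (a⁰·b¹)) = constPart (∂_X a) · constPart (∂_Y b)` for ALL `a, b` (no sign at all);
* **`constPart_bubble_colouring_1100`** / **`constPart_bubble_colouring_0011`** — the Feynman rule: for all `a, b`,
  `constPart (∂_{(Z₃,0)}∂_{(Z₂,0)}∂_{(Z₁,1)}∂_{(Z₀,1)} (Δ_×(C₁)Δ_×(C₂)(a⁰·b¹)))
     = −Σ_{X,Y,X',Y'} contr C₂ X Y · contr C₁ X' Y' · constPart(∂_{Z₃}∂_{Z₂}∂_{X'}∂_X a) · constPart(∂_{Z₁}∂_{Z₀}∂_{Y'}∂_Y b)`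
  — two propagators between the two vertices, legs `2,3` on `a`, legs `0,1` on `b`; and the mirror with legs `0,1` on `a`, `2,3` on `b`.
  With `kernel F 4 Z = (4!)⁻¹ constPart (∂_Z F)` and `constPart (∂_{Z₃}∂_{Z₂}∂_{X'}∂_X a) = 4!·kernel a 4 (X, X', Z₂, Z₃)` these are the usual
  «vertex × propagator × propagator × vertex» products (the `4!`'s are `vertexFn`'s normalisation).

Generic (commutative `ℚ`-algebra, finite labels); proved; no definitions; nothing about the model is asserted.
-/

noncomputable section

namespace Summit.HubbardSuperconductivity.HubbardSuperconductivity.Theorems.KLRegimeWick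

set_option linter.dupNamespace false -- summit = problem name (single-conjunct summit), D-0017

open Literature.MathematicalPhysics.QuantumLattice GrassmannAlgebra Finset Matrix

section Generic

variable (R : Type*) [CommRing R] [Algebra ℚ R] {Γ : Type*} [Fintype Γ] [DecidableEq Γ]

omit [Algebra ℚ R] in
/-- **Mirror block rule** (copy-`0` derivatives first, then copy-`1`): for ALL `a, b`,
`constPart (∂_{Ỹ} (∂_{X̃} (a⁰·b¹))) = constPart (∂_X a) · constPart (∂_Y b)` — no sign (the right factor passes freely, and the parity twist
`involute^{[m₁]}` on the left factor is invisible to `constPart`). -/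
theorem constPart_iterDeriv_copyZero_copyOne {m₀ m₁ : ℕ} (X : Fin m₀ → Γ) (Y : Fin m₁ → Γ) (a b : GrassmannAlgebra R Γ) :
    constPart R (iterDeriv R (fun i => (Y i, (1 : Fin 2)))
      (iterDeriv R (fun i => (X i, (0 : Fin 2))) (dblCopy R 0 a * dblCopy R 1 b))) =
      constPart R (iterDeriv R X a) * constPart R (iterDeriv R Y b) := by
  rw [iterDeriv_copyZero_mul R X _ (dblCopy_mem_fieldSubalgebra R 1 b), iterDeriv_dblCopy,
    iterDeriv_copyOne_mul R Y (dblCopy_mem_fieldSubalgebra R 0 _) (dblCopy_mem_fieldSubalgebra R 1 b), iterDeriv_dblCopy, map_mul,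
    constPart_dblCopy, involute_iterate_eq]
  -- `∂_X a` has parity `(−1)^{m₀}`·even; either branch has the same constant part
  by_cases hm : Even m₁
  · rw [if_pos hm, constPart_dblCopy]
  · rw [if_neg hm, involute_dblCopy, constPart_dblCopy, constPart_involute]

/-- **Feynman rule, colouring `(1,1,0,0)`** (legs `Z₀,Z₁` on copy `1` = `b`, legs `Z₂,Z₃` on copy `0` = `a`; copy-`1` derivatives applied first):
for all `a, b`,
`constPart (∂_{(Z₃,0)}∂_{(Z₂,0)} ∂_{(Z₁,1)}∂_{(Z₀,1)} (Δ_×(C₁)(Δ_×(C₂)(a⁰·b¹))))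
 = −Σ contr C₂ X Y · contr C₁ X' Y' · constPart(∂_{[Z₂,Z₃]}∂_{X'}∂_X a) · constPart(∂_{[Z₀,Z₁]}∂_{Y'}∂_Y b)`. -/
theorem constPart_bubble_colouring_1100 (C₁ C₂ : Matrix Γ Γ R) (a b : GrassmannAlgebra R Γ) (Z₀ Z₁ Z₂ Z₃ : Γ) :
    constPart R (iterDeriv R ![(Z₂, (0 : Fin 2)), (Z₃, 0)] (iterDeriv R ![(Z₀, (1 : Fin 2)), (Z₁, 1)]
      (grassmannLaplacian R (crossCov R C₁) (grassmannLaplacian R (crossCov R C₂) (dblCopy R 0 a * dblCopy R 1 b))))) =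
      -∑ X, ∑ Y, ∑ X', ∑ Y', contr R C₂ X Y * contr R C₁ X' Y' *
        (constPart R (iterDeriv R ![Z₂, Z₃] (grassmannDeriv R X' (grassmannDeriv R X a))) *
          constPart R (iterDeriv R ![Z₀, Z₁] (grassmannDeriv R Y' (grassmannDeriv R Y b)))) := by
  have key : ∀ (a' b' : GrassmannAlgebra R Γ),
      constPart R (iterDeriv R ![(Z₂, (0 : Fin 2)), (Z₃, 0)] (iterDeriv R ![(Z₀, (1 : Fin 2)), (Z₁, 1)]
        (dblCopy R 0 a' * dblCopy R 1 b'))) = constPart R (iterDeriv R ![Z₂, Z₃] a') * constPart R (iterDeriv R ![Z₀, Z₁] b') := by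
    intro a' b'
    have h := constPart_iterDeriv_iterDeriv_copy_mul_copy R (m₀ := 2) (m₁ := 2) ![Z₂, Z₃] ![Z₀, Z₁] a' b'
    have e0 : (fun i : Fin 2 => ((![Z₂, Z₃] : Fin 2 → Γ) i, (0 : Fin 2))) = ![(Z₂, (0 : Fin 2)), (Z₃, 0)] := by
      funext i; fin_cases i <;> rfl
    have e1 : (fun i : Fin 2 => ((![Z₀, Z₁] : Fin 2 → Γ) i, (1 : Fin 2))) = ![(Z₀, (1 : Fin 2)), (Z₁, 1)] := by
      funext i; fin_cases i <;> rfl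
    rw [e0, e1] at h
    rw [h, show (-1 : R) ^ (2 * 2) = 1 by norm_num, one_mul]
  rw [grassmannLaplacian_crossCov_crossCov_copy_mul_copy]
  simp only [map_neg, map_sum, map_smul, smul_eq_mul, key, mul_assoc]

/-- **Feynman rule, colouring `(0,0,1,1)`** (legs `Z₀,Z₁` on copy `0` = `a`, legs `Z₂,Z₃` on copy `1` = `b`; copy-`0` derivatives applied first): for
EVEN `a` and all `b`,
`constPart (∂_{(Z₃,1)}∂_{(Z₂,1)} ∂_{(Z₁,0)}∂_{(Z₀,0)} (Δ_×(C₁)(Δ_×(C₂)(a⁰·b¹))))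
 = −Σ contr C₂ X Y · contr C₁ X' Y' · constPart(∂_{[Z₀,Z₁]}∂_{X'}∂_X a) · constPart(∂_{[Z₂,Z₃]}∂_{Y'}∂_Y b)`. -/
theorem constPart_bubble_colouring_0011 (C₁ C₂ : Matrix Γ Γ R) (a b : GrassmannAlgebra R Γ) (Z₀ Z₁ Z₂ Z₃ : Γ) :
    constPart R (iterDeriv R ![(Z₂, (1 : Fin 2)), (Z₃, 1)] (iterDeriv R ![(Z₀, (0 : Fin 2)), (Z₁, 0)]
      (grassmannLaplacian R (crossCov R C₁) (grassmannLaplacian R (crossCov R C₂) (dblCopy R 0 a * dblCopy R 1 b))))) =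
      -∑ X, ∑ Y, ∑ X', ∑ Y', contr R C₂ X Y * contr R C₁ X' Y' *
        (constPart R (iterDeriv R ![Z₀, Z₁] (grassmannDeriv R X' (grassmannDeriv R X a))) *
          constPart R (iterDeriv R ![Z₂, Z₃] (grassmannDeriv R Y' (grassmannDeriv R Y b)))) := by
  have key : ∀ (a' b' : GrassmannAlgebra R Γ),
      constPart R (iterDeriv R ![(Z₂, (1 : Fin 2)), (Z₃, 1)] (iterDeriv R ![(Z₀, (0 : Fin 2)), (Z₁, 0)]
        (dblCopy R 0 a' * dblCopy R 1 b'))) = constPart R (iterDeriv R ![Z₀, Z₁] a') * constPart R (iterDeriv R ![Z₂, Z₃] b') := by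
    intro a' b'
    have h := constPart_iterDeriv_copyZero_copyOne R (m₀ := 2) (m₁ := 2) ![Z₀, Z₁] ![Z₂, Z₃] a' b'
    have e0 : (fun i : Fin 2 => ((![Z₀, Z₁] : Fin 2 → Γ) i, (0 : Fin 2))) = ![(Z₀, (0 : Fin 2)), (Z₁, 0)] := by
      funext i; fin_cases i <;> rfl
    have e1 : (fun i : Fin 2 => ((![Z₂, Z₃] : Fin 2 → Γ) i, (1 : Fin 2))) = ![(Z₂, (1 : Fin 2)), (Z₃, 1)] := by
      funext i; fin_cases i <;> rfl
    rw [e0, e1] at h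
    exact h
  rw [grassmannLaplacian_crossCov_crossCov_copy_mul_copy]
  simp only [map_neg, map_sum, map_smul, smul_eq_mul, key, mul_assoc]

end Generic

end Summit.HubbardSuperconductivity.HubbardSuperconductivity.Theorems.KLRegimeWick

end
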